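import Summits.AtomisticToContinuum.Crystallization.Theorems.FrustratedLawDichotomyStrainedPatchHomExteriorRayLeaf

/-!
# Strained patch, `(H)` hcp exterior certificate (architecture R3) — E3 STEP (3) FOR SIGNED-FLOOR CHAINS (the chained-curvature annulus (β), critic row 1470 (A4)):
# CERTIFIED DWELL BOUNDS on the break points and the length-weighted floor sum (decomp-a2c hand 2, generation 39; structural #11; DEF-FREE)

`…HomExteriorRayLeaf.hver_exterior_of_curvChecks_uniformFloor` (p854094) closes a slab target when every piece floor is `≥ ℓmin > 0`.  The annulus design (β) chains
SIGNED floors («tolerates negative curvature down to `ℓ⁻`»): then `Λ = Σ_k ℓ_k (θ_{k+1} − θ_k)` needs LOWER bounds on the dwell lengths of the positive pieces and UPPER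
bounds on those of the negative ones.  The break points of `…HomExteriorRay` are explicit (`exitParam` = suprema of the ray sets), so such bounds follow from POINT
facts a Bool verdict can certify uniformly over the cell box / slab box by interval arithmetic:

* §1 ray sets of CONVEX sets containing the base point are down-closed (`raySet_downClosed`); ★ `le_sSup_raySet_of_mem` (`ray a ∈ B`, `a ∈ [0,1]` ⟹ `a ≤ θ`) and
  ★ `sSup_raySet_le_of_not_mem` (`B` convex closed, `ray b ∉ B`, `b ∈ [0,1]` ⟹ `θ ≤ b`); `convex_xiBox`;
* §2 ★ `exitParam_xiBox_bounds`: for the chain of integer ξ-boxes, certified memberships `ray (a k) ∈ box (k−1)` and non-memberships `ray (b k) ∉ box (k−1)` (`1 ≤ k < m`)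
  bound the break points: `a k ≤ exitParam … k ≤ b k`; with `θ 0 = 0`, `θ m = 1`;
* §3 ★ `sum_floor_ge_signed`: `θ` monotone with `a k ≤ θ k ≤ b k` ⟹ `Σ_k ℓ k (θ (k+1) − θ k) ≥ Σ_k sgnFloor (ℓ k) (a k) (b k) (a (k+1)) (b (k+1))` where the summand is
  `ℓ k · max 0 (a (k+1) − b k)` for `ℓ k ≥ 0` and `ℓ k · (b (k+1) − a k)` for `ℓ k < 0`;
* §4 ★★★ `hver_exterior_of_curvChecks_signedFloor`: as the uniform-floor theorem but with per-piece signed floors `ℓlo k` (`ℓlo k·‖UΔ‖² ≤ M_k(UΔ)`), certified dwell data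
  `a, b` and the domination `S₇♯ + f₀ + |R|·6⁻⁷ < Λlo·‖UΔ‖`, `Λlo := Σ_k sgnFloor (ℓlo k) …` ⟹ the `hver` conclusion.

0 sorry; standard axioms; the only `def` is the transparent summand `sgnFloor`.  `--supports stmt-AtomisticToContinuum-27623`.  [folklore chaining]
-/

noncomputable section

open Set

namespace Summit.AtomisticToContinuum.Crystallization.Theorems.FrustratedLawDichotomyStrainedPatchHomExteriorRay

open scoped BigOperators RealInnerProductSpace
open Literature.Analysis.ValidatedNumerics.Numerics
open Summit.AtomisticToContinuum.Crystallization.Theorems.ChargedEnergyGapNegative (E3)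
open Summit.AtomisticToContinuum.Crystallization.Theorems.FrustratedLawDichotomySchurCut (effPot w₄₅ ω₄)
open Summit.AtomisticToContinuum.Crystallization.Theorems.FrustratedLawDichotomyAveragingRuleTightFree (TightNearCap BadNearCap)
open Summit.AtomisticToContinuum.Crystallization.Theorems.FrustratedLawDichotomyExemptAbsorption (ExemptNear)
open Summit.AtomisticToContinuum.Crystallization.Theorems.FrustratedLawDichotomyStrainedPatchHomSplit (ExRec latPt hexFrame hcpShift)
open Summit.AtomisticToContinuum.Crystallization.Theorems.FrustratedLawDichotomyStrainedPatchTaylorChord (segGd)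
open Summit.AtomisticToContinuum.Crystallization.Theorems.FrustratedLawDichotomyStrainedPatchHomCurvLJ (curvCheckLJM curvLJ_floorM_of_check)
open Summit.AtomisticToContinuum.Crystallization.Theorems.FrustratedLawDichotomyStrainedPatchHomExteriorTaylor (floor_transport hver_of_slabParts_pieces)

/-! ## §1 Ray sets of convex sets: down-closure and the two certified bounds on the exit parameter -/

section General
variable {E : Type*} [NormedAddCommGroup E] [NormedSpace ℝ E]

/-- For CONVEX `B ∋ ξ₀`, the ray set is down-closed: `s ∈ raySet`, `0 ≤ s' ≤ s` ⟹ `s' ∈ raySet`. [folklore: `ray s' ∈ segment ξ₀ (ray s)`] -/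
theorem raySet_downClosed {ξ₀ ξ : E} {B : Set E} (hB : Convex ℝ B) (h0 : ξ₀ ∈ B) {s s' : ℝ} (hs : s ∈ raySet ξ₀ ξ B) (h0s' : 0 ≤ s') (hs's : s' ≤ s) :
    s' ∈ raySet ξ₀ ξ B := by
  refine ⟨⟨h0s', hs's.trans hs.1.2⟩, ?_⟩
  have hmem : ξ₀ + s • (ξ - ξ₀) ∈ B := hs.2
  show ξ₀ + s' • (ξ - ξ₀) ∈ B
  rcases eq_or_lt_of_le hs.1.1 with hs0 | hspos
  · -- s = 0 ⇒ s' = 0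
    have : s' = 0 := le_antisymm (hs's.trans hs0.symm.le) h0s'
    rw [this, zero_smul, add_zero]; exact h0
  · -- convex combination of ξ₀ and the ray point at s with weight s'/s
    have hdec : ξ₀ + s' • (ξ - ξ₀) = (1 - s' / s) • ξ₀ + (s' / s) • (ξ₀ + s • (ξ - ξ₀)) := by
      have hs1 : s' / s * s = s' := div_mul_cancel₀ s' hspos.ne'
      rw [smul_add, smul_smul, hs1, sub_smul, one_smul]
      abel
    rw [hdec]
    exact hB h0 hmem (by linarith [div_le_one_of_le₀ hs's hs.1.1]) (div_nonneg h0s' hs.1.1) (by ring)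

/-- ★ **CERTIFIED LOWER BOUND**: a ray point `ray a ∈ B` with `a ∈ [0,1]` bounds the exit parameter from below: `a ≤ sSup (raySet ξ₀ ξ B)`. [formal bookkeeping: `le_csSup`] -/
theorem le_sSup_raySet_of_mem {ξ₀ ξ : E} {B : Set E} {a : ℝ} (ha : a ∈ Icc (0 : ℝ) 1) (hmem : ξ₀ + a • (ξ - ξ₀) ∈ B) :
    a ≤ sSup (raySet ξ₀ ξ B) :=
  le_csSup (raySet_bdd ξ₀ ξ B) ⟨ha, hmem⟩

/-- ★ **CERTIFIED UPPER BOUND**: for convex closed `B ∋ ξ₀`, a ray point `ray b ∉ B` with `b ∈ [0,1]` bounds the exit parameter from above: `sSup (raySet ξ₀ ξ B) ≤ b`.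
[folklore: down-closure + the sup is attained] -/
theorem sSup_raySet_le_of_not_mem {ξ₀ ξ : E} {B : Set E} (hBc : Convex ℝ B) (hB : IsClosed B) (h0 : ξ₀ ∈ B) {b : ℝ} (hb : b ∈ Icc (0 : ℝ) 1)
    (hnot : ξ₀ + b • (ξ - ξ₀) ∉ B) : sSup (raySet ξ₀ ξ B) ≤ b := by
  by_contra hle
  have hlt : b < sSup (raySet ξ₀ ξ B) := not_le.mp hle
  have hsup := sSup_raySet_mem (ξ := ξ) hB h0
  have hbmem := raySet_downClosed hBc h0 hsup hb.1 hlt.le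
  exact hnot hbmem.2

end General

/-- The ξ-box is convex. [folklore] -/
theorem convex_xiBox (c w : (Fin 3 × Fin 3) ⊕ Fin 3 → ℤ) : Convex ℝ (xiBox c w) := by
  intro x hx y hy a b ha hb hab i
  have h1 := hx i
  have h2 := hy i
  have e : (a • x + b • y) i - (c (Sum.inr i) : ℝ) / SC = a * (x i - (c (Sum.inr i) : ℝ) / SC) + b * (y i - (c (Sum.inr i) : ℝ) / SC) := by
    simp only [PiLp.add_apply, PiLp.smul_apply, smul_eq_mul]
    linear_combination ((c (Sum.inr i) : ℝ) / SC) * hab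
  rw [e]
  calc |a * (x i - (c (Sum.inr i) : ℝ) / SC) + b * (y i - (c (Sum.inr i) : ℝ) / SC)|
      ≤ |a * (x i - (c (Sum.inr i) : ℝ) / SC)| + |b * (y i - (c (Sum.inr i) : ℝ) / SC)| := abs_add_le _ _
    _ = a * |x i - (c (Sum.inr i) : ℝ) / SC| + b * |y i - (c (Sum.inr i) : ℝ) / SC| := by
        rw [abs_mul, abs_mul, abs_of_nonneg ha, abs_of_nonneg hb]
    _ ≤ a * ((w (Sum.inr i) : ℝ) / SC) + b * ((w (Sum.inr i) : ℝ) / SC) := by gcongr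
    _ = (w (Sum.inr i) : ℝ) / SC := by rw [← add_mul, hab, one_mul]

/-! ## §2 Certified bounds on the break points of a chain of integer ξ-boxes -/

/-- ★ **CERTIFIED DWELL BOUNDS**: for the break points `θ = exitParam ξ₀ ξ (xiBox ∘ chain) m` and every `1 ≤ k < m`, a certified membership `ray (a k) ∈ box (k−1)` gives
`a k ≤ θ k` and a certified non-membership `ray (b k) ∉ box (k−1)` gives `θ k ≤ b k` (`a k, b k ∈ [0,1]`); `θ 0 = 0`, `θ k = 1` for `m ≤ k`. [folklore] -/
theorem exitParam_xiBox_bounds {ξ₀ ξ : E3} (cs ws : ℕ → ((Fin 3 × Fin 3) ⊕ Fin 3 → ℤ)) (m : ℕ) (hm : 0 < m)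
    (h0 : ∀ i : Fin 3, |ξ₀ i - (cs 0 (Sum.inr i) : ℝ) / SC| ≤ (ws 0 (Sum.inr i) : ℝ) / SC)
    (hnest : ∀ k, k + 1 < m → ∀ i : Fin 3, cs (k + 1) (Sum.inr i) - ws (k + 1) (Sum.inr i) ≤ cs k (Sum.inr i) - ws k (Sum.inr i) ∧
      cs k (Sum.inr i) + ws k (Sum.inr i) ≤ cs (k + 1) (Sum.inr i) + ws (k + 1) (Sum.inr i))
    (a b : ℕ → ℝ)
    (ha : ∀ k, 1 ≤ k → k < m → a k ∈ Icc (0 : ℝ) 1 ∧ ∀ i : Fin 3, |(ξ₀ + a k • (ξ - ξ₀)) i - (cs (k - 1) (Sum.inr i) : ℝ) / SC| ≤ (ws (k - 1) (Sum.inr i) : ℝ) / SC)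
    (hb : ∀ k, 1 ≤ k → k < m → b k ∈ Icc (0 : ℝ) 1 ∧ ∃ i : Fin 3, (ws (k - 1) (Sum.inr i) : ℝ) / SC < |(ξ₀ + b k • (ξ - ξ₀)) i - (cs (k - 1) (Sum.inr i) : ℝ) / SC|) :
    (exitParam ξ₀ ξ (fun k => xiBox (cs k) (ws k)) m 0 = 0) ∧ (∀ k, m ≤ k → exitParam ξ₀ ξ (fun k => xiBox (cs k) (ws k)) m k = 1) ∧
      ∀ k, 1 ≤ k → k < m → a k ≤ exitParam ξ₀ ξ (fun k => xiBox (cs k) (ws k)) m k ∧ exitParam ξ₀ ξ (fun k => xiBox (cs k) (ws k)) m k ≤ b k := by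
  -- ξ₀ lies in every box of the chain
  have hin : ∀ k, k < m → ξ₀ ∈ xiBox (cs k) (ws k) := by
    intro k
    induction k with
    | zero => intro _; exact h0
    | succ n ih => intro hk; exact xiBox_mono (hnest n hk) (ih (by omega))
  refine ⟨by simp [exitParam], fun k hk => ?_, fun k hk1 hkm => ?_⟩
  · have hk0 : k ≠ 0 := by omega
    simp [exitParam, hk0, hk]
  · have hk0 : k ≠ 0 := by omega
    have hkm' : ¬ m ≤ k := by omega
    have hθ : exitParam ξ₀ ξ (fun k => xiBox (cs k) (ws k)) m k = sSup (raySet ξ₀ ξ (xiBox (cs (k - 1)) (ws (k - 1)))) := by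
      simp [exitParam, hk0, hkm']
    rw [hθ]
    constructor
    · exact le_sSup_raySet_of_mem (ha k hk1 hkm).1 ((mem_xiBox).2 (ha k hk1 hkm).2)
    · refine sSup_raySet_le_of_not_mem (convex_xiBox _ _) (isClosed_xiBox _ _) (hin (k - 1) (by omega)) (hb k hk1 hkm).1 ?_
      intro hmem
      obtain ⟨i, hi⟩ := (hb k hk1 hkm).2
      exact absurd ((mem_xiBox).1 hmem i) (not_le.2 hi)

/-! ## §3 The length-weighted signed floor sum -/

/-- The certified contribution of piece `k`: `ℓ·max 0 (a' − b)` if `ℓ ≥ 0` (shortest possible dwell `[b, a']`), `ℓ·(b' − a)` if `ℓ < 0` (longest possible dwell `[a, b']`). -/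
def sgnFloor (ℓ a b a' b' : ℝ) : ℝ := if 0 ≤ ℓ then ℓ * max 0 (a' - b) else ℓ * (b' - a)

/-- ★ **SIGNED FLOOR SUM**: `θ` monotone with `a k ≤ θ k ≤ b k` for all `k ≤ m` ⟹ `Σ_{k<m} sgnFloor (ℓ k) (a k) (b k) (a (k+1)) (b (k+1)) ≤ Σ_{k<m} ℓ k (θ (k+1) − θ k)`. [arithmetic] -/
theorem sum_floor_ge_signed (m : ℕ) (θ ℓ a b : ℕ → ℝ) (hmono : ∀ k, k < m → θ k ≤ θ (k + 1)) (hlo : ∀ k, k ≤ m → a k ≤ θ k)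
    (hhi : ∀ k, k ≤ m → θ k ≤ b k) :
    ∑ k ∈ Finset.range m, sgnFloor (ℓ k) (a k) (b k) (a (k + 1)) (b (k + 1)) ≤ ∑ k ∈ Finset.range m, ℓ k * (θ (k + 1) - θ k) := by
  refine Finset.sum_le_sum fun k hk => ?_
  have hk' := Finset.mem_range.1 hk
  have h1 := hlo k hk'.le
  have h2 := hhi k hk'.le
  have h3 := hlo (k + 1) (by omega)
  have h4 := hhi (k + 1) (by omega)
  have h5 := hmono k hk'
  unfold sgnFloor
  split_ifs with hℓ
  · refine mul_le_mul_of_nonneg_left ?_ hℓ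
    exact max_le (by linarith) (by linarith)
  · have hℓ' : ℓ k < 0 := not_le.mp hℓ
    exact mul_le_mul_of_nonpos_left (by linarith) hℓ'.le

/-! ## §4 ★★★ E3 step (3) for signed-floor chains -/

/-- ★★★ **E3 STEP (3), SIGNED-FLOOR CHAINS (the chained-curvature annulus (β)): the `hver` conclusion at an exterior target from the kernel box chain with SIGNED per-piece
direction floors `ℓlo k`, CERTIFIED DWELL DATA `a, b` (point memberships / non-memberships of two ray points per interior break point) and ONE domination inequality
`S₇♯ + f₀ + |R|·6⁻⁷ < Λlo·‖UΔ‖`, `Λlo := Σ_k sgnFloor (ℓlo k) (a k) (b k) (a (k+1)) (b (k+1))` with `a 0 = b 0 = 0`, `a m = b m = 1`.**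
[folklore chaining: `exitParam_xiBox_bounds` + `sum_floor_ge_signed` + `hfloor`-chain + `hver_of_slabParts_pieces`, `hslab` vacuous] -/
theorem hver_exterior_of_curvChecks_signedFloor {μ : ℤ} {U : E3 →L[ℝ] E3} {ξ₀ ξ : E3} (hU : ‖U - 1‖ ≤ 1 / 4) (hn₀ : ‖ξ₀‖ ≤ 1 / 4) (hn : ‖ξ‖ ≤ 1 / 4)
    (B R : Finset (Fin 3 → ℤ)) (hB : B ⊆ Fintype.piFinset fun _ : Fin 3 => Finset.Icc (-11 : ℤ) 11)
    (hBin : ∀ bb ∈ B, ‖latPt U hexFrame bb + U (hcpShift + ξ)‖ ≤ 7)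
    (hR : ∀ bb ∈ (Fintype.piFinset fun _ : Fin 3 => Finset.Icc (-11 : ℤ) 11) \ B, ‖latPt U hexFrame bb + U (hcpShift + ξ)‖ ≤ 7 →
      bb ∈ R ∧ 6 ≤ ‖latPt U hexFrame bb + U (hcpShift + ξ)‖)
    {f₀ : ℝ}
    (hf₀ : |∑ bb ∈ B, (‖latPt U hexFrame bb + U (hcpShift + ξ₀)‖⁻¹ ^ 8 - ‖latPt U hexFrame bb + U (hcpShift + ξ₀)‖⁻¹ ^ 14) *
        ⟪latPt U hexFrame bb + U (hcpShift + ξ₀), U (ξ - ξ₀)⟫| ≤ f₀ * ‖U (ξ - ξ₀)‖)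
    (m : ℕ) (hm : 0 < m) (cs ws : ℕ → ((Fin 3 × Fin 3) ⊕ Fin 3 → ℤ)) (Lc Ln : ℕ → List (Fin 3 → ℤ)) (D : ℕ → Fin 3 → Fin 3 → ℤ) (lam : ℕ → ℤ)
    (hLB : ∀ k, k < m → (Lc k ++ Ln k).toFinset = B) (hnd : ∀ k, k < m → (Lc k ++ Ln k).Nodup)
    (hchk : ∀ k, k < m → curvCheckLJM (cs k) (ws k) (Lc k) (Ln k) (D k) (lam k) = true)
    (hUbox : ∀ k, k < m → ∀ ab : Fin 3 × Fin 3, |(U (EuclideanSpace.single ab.2 (1 : ℝ))) ab.1 - (cs k (Sum.inl ab) : ℝ) / SC| ≤ (ws k (Sum.inl ab) : ℝ) / SC)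
    (hnest : ∀ k, k + 1 < m → ∀ i : Fin 3, cs (k + 1) (Sum.inr i) - ws (k + 1) (Sum.inr i) ≤ cs k (Sum.inr i) - ws k (Sum.inr i) ∧
      cs k (Sum.inr i) + ws k (Sum.inr i) ≤ cs (k + 1) (Sum.inr i) + ws (k + 1) (Sum.inr i))
    (h0 : ∀ i : Fin 3, |ξ₀ i - (cs 0 (Sum.inr i) : ℝ) / SC| ≤ (ws 0 (Sum.inr i) : ℝ) / SC)
    (h1 : ∀ i : Fin 3, |ξ i - (cs (m - 1) (Sum.inr i) : ℝ) / SC| ≤ (ws (m - 1) (Sum.inr i) : ℝ) / SC) (hΔ : U (ξ - ξ₀) ≠ 0)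
    (ℓlo : ℕ → ℝ)
    (hℓ : ∀ k, k < m → ℓlo k * ‖U (ξ - ξ₀)‖ ^ 2 ≤
      (lam k : ℝ) / SC * ‖U (ξ - ξ₀)‖ ^ 2 + ∑ i : Fin 3, ∑ j : Fin 3, (D k i j : ℝ) / SC * ((U (ξ - ξ₀)) i * (U (ξ - ξ₀)) j))
    (a b : ℕ → ℝ) (ha0 : a 0 = 0) (hb0 : b 0 = 0) (ham : a m = 1) (hbm : b m = 1)
    (ha : ∀ k, 1 ≤ k → k < m → a k ∈ Icc (0 : ℝ) 1 ∧ ∀ i : Fin 3, |(ξ₀ + a k • (ξ - ξ₀)) i - (cs (k - 1) (Sum.inr i) : ℝ) / SC| ≤ (ws (k - 1) (Sum.inr i) : ℝ) / SC)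
    (hb : ∀ k, 1 ≤ k → k < m → b k ∈ Icc (0 : ℝ) 1 ∧ ∃ i : Fin 3, (ws (k - 1) (Sum.inr i) : ℝ) / SC < |(ξ₀ + b k • (ξ - ξ₀)) i - (cs (k - 1) (Sum.inr i) : ℝ) / SC|)
    (hdom : (6000 / 343 * (7 : ℝ)⁻¹ ^ 4 + 2880 / 49 * (7 : ℝ)⁻¹ ^ 5 + 10 / 7 * (7 : ℝ)⁻¹ ^ 6 + 2 * (7 : ℝ)⁻¹ ^ 7) + f₀ + R.card * (6 : ℝ)⁻¹ ^ 7 <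
      (∑ k ∈ Finset.range m, sgnFloor (ℓlo k) (a k) (b k) (a (k + 1)) (b (k + 1))) * ‖U (ξ - ξ₀)‖) :
    (∀ (M : ℕ) (z : Fin M → E3) (cc : Fin M), Function.Injective z →
        Set.range z = {x : E3 | dist x (z cc) ≤ 133 / 10 ∧ ∃ a : Fin 3 → ℤ,
          x = z cc + latPt U hexFrame a ∨ x = z cc + latPt U hexFrame a + U (hcpShift + ξ)} →
        TightNearCap (9 / 5) (3 / 2) z cc ∨ ExemptNear (9 / 5) ExRec z cc ∨ BadNearCap (9 / 5) (3 / 2) z cc) ∨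
      (μ : ℝ) / SC ≤ ∑ b ∈ (Fintype.piFinset fun _ : Fin 3 => Finset.Icc (-7 : ℤ) 7).filter (fun b => b ≠ 0), effPot w₄₅ ω₄ (3 / 400) ‖latPt U hexFrame b‖ +
        ∑ b ∈ (Fintype.piFinset fun _ : Fin 3 => Finset.Icc (-7 : ℤ) 7), effPot w₄₅ ω₄ (3 / 400) ‖latPt U hexFrame b + U (hcpShift + ξ)‖ := by
  have hpos : 0 < ‖U (ξ - ξ₀)‖ := norm_pos_iff.2 hΔ
  -- the break points are the explicit `exitParam`s: reuse the construction of `exists_exitChain` through its xiBox form, then bound them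
  -- (we re-derive the chain facts for θ := exitParam directly)
  obtain ⟨hθ0, hθtop, hbounds⟩ := exitParam_xiBox_bounds (ξ₀ := ξ₀) (ξ := ξ) cs ws m hm h0 hnest a b ha hb
  set θ : ℕ → ℝ := exitParam ξ₀ ξ (fun k => xiBox (cs k) (ws k)) m with hθdef
  -- the chain floor with ITS θ: `exists_exitChain_xiBox` produced some θ'; but we need the floors for OUR explicit θ.  Both are the same function by
  -- construction (`exists_exitChain` is proved with `exitParam`); to stay independent of that proof term we re-run the two kit steps here.
  have hin : ∀ k, k < m → ξ₀ ∈ xiBox (cs k) (ws k) := by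
    intro k
    induction k with
    | zero => intro _; exact h0
    | succ n ih => intro hk; exact xiBox_mono (hnest n hk) (ih (by omega))
  have hθmid : ∀ k, 1 ≤ k → k < m → θ k = sSup (raySet ξ₀ ξ (xiBox (cs (k - 1)) (ws (k - 1)))) := by
    intro k hk1 hkm
    have hk0 : k ≠ 0 := by omega
    have hkm' : ¬ m ≤ k := by omega
    simp [hθdef, exitParam, hk0, hkm']
  have hsup : ∀ k, k < m → sSup (raySet ξ₀ ξ (xiBox (cs k) (ws k))) ∈ raySet ξ₀ ξ (xiBox (cs k) (ws k)) := fun k hk =>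
    sSup_raySet_mem (isClosed_xiBox _ _) (hin k hk)
  -- range, monotonicity, ray points (as in `exists_exitChain`)
  have hrange : ∀ k, k ≤ m → θ k ∈ Icc (0 : ℝ) 1 := by
    intro k hk
    by_cases hk0 : k = 0
    · subst hk0; rw [hθ0]; exact ⟨le_rfl, zero_le_one⟩
    · by_cases hkm : m ≤ k
      · rw [hθtop k hkm]; exact ⟨zero_le_one, le_rfl⟩
      · rw [hθmid k (by omega) (by omega)]; exact (hsup (k - 1) (by omega)).1
  have hmono : ∀ k, k < m → θ k ≤ θ (k + 1) := by
    intro k hk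
    by_cases hk0 : k = 0
    · subst hk0; rw [hθ0]; exact (hrange 1 (by omega)).1
    · by_cases hkm : m ≤ k + 1
      · rw [hθtop (k + 1) hkm]; exact (hrange k hk.le).2
      · rw [hθmid k (by omega) hk, hθmid (k + 1) (by omega) (by omega)]
        simp only [Nat.add_sub_cancel]
        apply csSup_le_csSup (raySet_bdd ξ₀ ξ _) ⟨0, zero_mem_raySet (hin (k - 1) (by omega))⟩
        intro s hs
        have hsub := xiBox_mono (c := cs (k - 1)) (w := ws (k - 1)) (c' := cs k) (w' := ws k) (by
          have := hnest (k - 1) (by omega); rwa [show k - 1 + 1 = k by omega] at this)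
        exact ⟨hs.1, hsub hs.2⟩
  have hpts : ∀ k, k < m → ξ₀ + θ k • (ξ - ξ₀) ∈ xiBox (cs k) (ws k) ∧ ξ₀ + θ (k + 1) • (ξ - ξ₀) ∈ xiBox (cs k) (ws k) := by
    intro k hk
    constructor
    · by_cases hk0 : k = 0
      · subst hk0; rw [hθ0, zero_smul, add_zero]; exact h0
      · rw [hθmid k (by omega) hk]
        have hmem := (hsup (k - 1) (by omega)).2
        have hsub := xiBox_mono (c := cs (k - 1)) (w := ws (k - 1)) (c' := cs k) (w' := ws k) (by
          have := hnest (k - 1) (by omega); rwa [show k - 1 + 1 = k by omega] at this)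
        exact hsub hmem
    · by_cases hkm : m ≤ k + 1
      · rw [hθtop (k + 1) hkm]
        have : k = m - 1 := by omega
        subst this
        rw [one_smul, add_sub_cancel]; exact h1
      · rw [hθmid (k + 1) (by omega) (by omega)]
        simp only [Nat.add_sub_cancel]
        exact (hsup k hk).2
  -- dwell bounds for all k ≤ m
  have hlo : ∀ k, k ≤ m → a k ≤ θ k := by
    intro k hk
    by_cases hk0 : k = 0
    · subst hk0; rw [hθ0, ha0]
    · by_cases hkm : m ≤ k
      · have : k = m := le_antisymm hk hkm
        subst this; rw [hθtop k le_rfl, ham]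
      · exact (hbounds k (by omega) (by omega)).1
  have hhi : ∀ k, k ≤ m → θ k ≤ b k := by
    intro k hk
    by_cases hk0 : k = 0
    · subst hk0; rw [hθ0, hb0]
    · by_cases hkm : m ≤ k
      · have : k = m := le_antisymm hk hkm
        subst this; rw [hθtop k le_rfl, hbm]
      · exact (hbounds k (by omega) (by omega)).2
  -- the piece floors ℓ k := M_k(UΔ)/‖UΔ‖²
  set ℓ : ℕ → ℝ := fun k =>
    ((lam k : ℝ) / SC * ‖U (ξ - ξ₀)‖ ^ 2 + ∑ i : Fin 3, ∑ j : Fin 3, (D k i j : ℝ) / SC * ((U (ξ - ξ₀)) i * (U (ξ - ξ₀)) j)) / ‖U (ξ - ξ₀)‖ ^ 2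
    with hℓdef
  have hℓge : ∀ k, k < m → ℓlo k ≤ ℓ k := by
    intro k hk
    rw [hℓdef]; simp only
    rw [le_div_iff₀ (pow_pos hpos 2)]
    exact hℓ k hk
  -- hfloor for OUR θ: rerun steps (1)+(2) per piece
  have hfloor : ∀ k, k < m → ∀ s ∈ Ioo (θ k) (θ (k + 1)),
      ℓ k * ‖U (ξ - ξ₀)‖ ^ 2 ≤ ∑ bb ∈ B, segGd (fun x : ℝ => x⁻¹ ^ 7 - x⁻¹ ^ 13) (latPt U hexFrame bb + U (hcpShift + ξ₀)) (U (ξ - ξ₀)) s := by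
    intro k hk s hs
    have hlt : θ k < θ (k + 1) := hs.1.trans hs.2
    set t : ℝ := θ (k + 1) - θ k with ht
    have htpos : 0 < t := by rw [ht]; linarith
    set u : ℝ := (s - θ k) / t with hu
    have hu01 : u ∈ Ioo (0 : ℝ) 1 := by
      constructor
      · rw [hu]; exact div_pos (by linarith [hs.1]) htpos
      · rw [hu, div_lt_one htpos, ht]; linarith [hs.2]
    have hsu : θ k + t * u = s := by rw [hu]; field_simp; ring
    have hP₀n : ‖ξ₀ + θ k • (ξ - ξ₀)‖ ≤ 1 / 4 := norm_rayPoint_le hn₀ hn (hrange k hk.le)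
    have hP₁n : ‖ξ₀ + θ (k + 1) • (ξ - ξ₀)‖ ≤ 1 / 4 := norm_rayPoint_le hn₀ hn (hrange (k + 1) (by omega))
    have hfl := curvLJ_floorM_of_check (hnd k hk) (hchk k hk) U hU (hUbox k hk) (ξ₀ + θ k • (ξ - ξ₀)) (ξ₀ + θ (k + 1) • (ξ - ξ₀))
      ((mem_xiBox).1 (hpts k hk).1) ((mem_xiBox).1 (hpts k hk).2) hP₀n hP₁n hu01
    rw [hLB k hk, rayPoint_sub, map_smul, mForm_smul] at hfl
    simp only [basePoint_ray] at hfl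
    have hκ : ℓ k * ‖t • U (ξ - ξ₀)‖ ^ 2 =
        t ^ 2 * ((lam k : ℝ) / SC * ‖U (ξ - ξ₀)‖ ^ 2 + ∑ i : Fin 3, ∑ j : Fin 3, (D k i j : ℝ) / SC * ((U (ξ - ξ₀)) i * (U (ξ - ξ₀)) j)) := by
      have hnz : ‖U (ξ - ξ₀)‖ ^ 2 ≠ 0 := pow_ne_zero 2 hpos.ne'
      rw [hℓdef]; simp only
      rw [norm_smul, mul_pow, Real.norm_eq_abs, sq_abs]
      field_simp
    have key := floor_transport B (fun x : ℝ => x⁻¹ ^ 7 - x⁻¹ ^ 13) (fun bb => latPt U hexFrame bb + U (hcpShift + ξ₀)) (U (ξ - ξ₀))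
      (s₁ := θ k) (t := t) (u := u) (κ := ℓ k) htpos.ne' (by rw [hκ]; exact hfl)
    rw [hsu] at key
    exact key
  -- signed floor sum ⇒ Λ ≥ Λlo ⇒ hslab vacuous
  have hΛ : ∑ k ∈ Finset.range m, sgnFloor (ℓlo k) (a k) (b k) (a (k + 1)) (b (k + 1)) ≤ ∑ k ∈ Finset.range m, ℓ k * (θ (k + 1) - θ k) := by
    refine (sum_floor_ge_signed m θ ℓlo a b hmono hlo hhi).trans ?_
    refine Finset.sum_le_sum fun k hk => ?_
    exact mul_le_mul_of_nonneg_right (hℓge k (Finset.mem_range.1 hk)) (by linarith [hmono k (Finset.mem_range.1 hk)])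
  refine hver_of_slabParts_pieces (μ := μ) hU hn₀ hn B R hB hBin hR m θ ℓ hθ0 (hθtop m le_rfl) hmono (f₀ := f₀) hfloor hf₀ ?_
  intro hq
  exfalso
  have h2 : (∑ k ∈ Finset.range m, sgnFloor (ℓlo k) (a k) (b k) (a (k + 1)) (b (k + 1))) * ‖U (ξ - ξ₀)‖ ^ 2 ≤
      (∑ k ∈ Finset.range m, ℓ k * (θ (k + 1) - θ k)) * ‖U (ξ - ξ₀)‖ ^ 2 := mul_le_mul_of_nonneg_right hΛ (sq_nonneg _)
  have h3 : ((6000 / 343 * (7 : ℝ)⁻¹ ^ 4 + 2880 / 49 * (7 : ℝ)⁻¹ ^ 5 + 10 / 7 * (7 : ℝ)⁻¹ ^ 6 + 2 * (7 : ℝ)⁻¹ ^ 7) + f₀ + R.card * (6 : ℝ)⁻¹ ^ 7) *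
      ‖U (ξ - ξ₀)‖ < (∑ k ∈ Finset.range m, sgnFloor (ℓlo k) (a k) (b k) (a (k + 1)) (b (k + 1))) * ‖U (ξ - ξ₀)‖ * ‖U (ξ - ξ₀)‖ :=
    mul_lt_mul_of_pos_right hdom hpos
  nlinarith [h2, h3, hq]

end Summit.AtomisticToContinuum.Crystallization.Theorems.FrustratedLawDichotomyStrainedPatchHomExteriorRay

end
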